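import Summits.QuantumFields.YangMills.Theorems.BalabanLadderUVSeamRecFlowWindow
import Summits.QuantumFields.YangMills.Theorems.BalabanLadderUVSeamRecStubTransport
import Literature.MathematicalPhysics.QuantumFieldTheory.Balaban1983to89.T4Continuum
import HarnessLib

/-!
# Crux `UVSeamRec` (stmt-QuantumFields-20043), stub `stub_ceilings`: the FLOW HALF of E0′, part 2 —
# with the two-loop coefficients read in the unit of record, Bałaban's window reaches `uRec` (at every finite-ε datum)

Helper file (`--supports stmt-QuantumFields-20043`) of the lead prover (unit `ym-spine-20043-p1`, gen 5); part 1 is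
`BalabanLadderUVSeamRecFlowWindow` (the discrete comparison and the flow-level window); companions
`BalabanLadderUVSeamRecCeilingsTransfer` (p442252: `momentBounds6_of_eventually_le`, ceilings move from a unit `a` to any
`u` with `∀ᶠ β, a β ≤ c·u β`) and `BalabanLadderUVSeamRecFloorsEngineOfWindow` (p448741:
`momentBounds6_uRec_of_fbl6_commensurable`).  Answers the flow-side part of the route owner's ask R6 (b) of
RULING-parity-S0-g21 («first lemma of E0′ typed over existing decls») and LOCATES the input that RULING R27 (3) asks
the 20043 lead to name.

WHAT `stub_ceilings : UV → MomentBounds6 SU(2) rF uRec` MUST CONSUME ON THE FLOW SIDE (located, numbers).  The seam's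
currency `MomentBounds6 G r u` (`LangevinControlUVOSLegsFromFemtoAndGapDefs` :322) asks ceilings for EVERY Wilson coupling
`β ≥ β₄` at separations `R ≤ ℓ₄/u(β)`; the landed transfer needs the producing unit `a` to satisfy `a ≤ c·uRec`
eventually with a CONSTANT `c`.  Bałaban's theorems control a run `⟨K, m, g₀⟩` of his construction only while its
couplings stay in `]0, γ]` (`Setup.Flow.InInterval`, the standing hypothesis of [Balaban1989LargeFieldII] Thm 1 =
`B16.Thm1Printed`, first conjunct of the `(B)` conjunct `B16.EndStatementBPrinted D.C` of `UV`); after `K` steps the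
controlled scale is `L^K` lattice spacings, i.e. the unit `a_B(β) = L^{−K(β)}` where `K(β)` is the number of steps the
run from the bare coupling of Wilson coupling `β` stays in the interval.  `a_B ≤ c·uRec` therefore says: the window
`K(β) ≥ log_L(1/uRec β) − O(1) = [β/(4b₀) − (b₁/(2b₀²)) log β]/log L − O(1)` — TWO-LOOP accuracy up to O(1) steps.
Thm 2 of [Balaban1987RG1] as printed ((0.31): `b ≤ β_k ≤ b′`, constants) gives the window only up to a LINEAR number
of steps (exponential-rate mismatch); a one-loop bound `β_k ≤ a + O(γ²)` (tree `FlowStep.BetaPertH`) up to `O(γ²β)`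
steps; one-loop-sharp `β_k ≤ a + O(g²)` up to `O(log β)` steps (power-of-β mismatch) — none gives a constant `c`.
NO conjunct of `UV` (Stage-0 text, Theses/BalabanLadder.lean), of the θ-package `Cruxes.UV.Record13.UVAtParams13 2`
(Theorems/BalabanLadderUVRecord13Defs.lean) or of Track A's K2‴ `BalabanUVNodes.EndpointGivenBR13` carries ANY bound on
the β-functions (they export `DagBinding.EndpointExistence` only).  So the input below is NEW to the UV item in both
texts: it is the «asymptotic scaling a_B ≤ c·u of the tuned flow of record» named informally in the crux text, now
typed at its minimal strength.

THE INPUT (hypothesis shape, never asserted here; unprinted — two-loop lattice perturbation theory of Bałaban's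
block-spin effective actions with remainder bounds): a ONE-SIDED TWO-LOOP UPPER BOUND on the history family
`β : FlowStep.HBeta` that forward-generates the construction (`DagBinding.ForwardGenerated`, [Balaban1987RG1]
(0.17)–(0.20)), on the boxes `]0, γ₀]^{k+1}`:
    `β_k(g_0, …, g_k) ≤ a + δ_k + b·g_k² + C·g_k⁴`,   `a = 4κ·b₀·log L`,  `b = 8κ²·b₁·log L`,
with `δ_k ≥ 0` of bounded partial sums (absorbs scale-dependent coefficients converging from above at a summable rate —
cf. the tree's sharpness witnesses `BalabanUV/Beta/EriceFlowEnclosureBareAsymptoticsSharp` ∕ `…BareTwoLoopRate` for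
Erice's (3.76), where the convergence RATE is load-bearing), any quartic remainder `C ≥ 0`, and `κ` the normalisation
of the bare point `1/g₀² = κ·β` (`κ = 2` for the tree's `SU(2)` instance of Bałaban's `GaugeGroup`, whose `reTr` is
the NORMALISED trace: `Missing.boltzmann = exp(−g₀⁻² Σ_p (1 − ½ Re Tr U_p)) = exp(−β Σ_p Re tr(1 − U_p))` with
`β = 1/(2g₀²)`; `FemtoTransferGap.sizeLog`'s «g² = 2/β» is the standard coupling `g² = 4 g₀²`).  The coefficients are
the universal ones READ IN THE UNIT OF RECORD: `(log L/a)·κβ = β/(4b₀)` and `b·log L/a² = b₁/(2b₀²)`.  NOT needed: a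
lower bound, a sign, convergence of the β-functions, tuning, endpoint existence, `(B)`.

WHAT THIS FILE PROVES (0 sorry, axioms standard):
§4 `window_reaches_uRec` — for `C : B12.Construction` forward-generated by `β` with
   `β_k ≤ 4κb₀ log L + δ_k + 8κ²b₁ log L·g_k² + C·g_k⁴` on the boxes: a step count `K(β)`, a constant `c > 0` and a
   threshold `β₁` with, for all Wilson couplings `β ≥ β₁` and every torus exponent `m`,
   `⟨K(β), m, (κβ)^{-1/2}⟩ ∈ InInterval γ (K β)` AND `L^{−K(β)} ≤ c · Transport.uRec β`.
§5 `datum_window_reaches_uRec`, `datum_unit_eventually_le` — the same read at a finite-ε datum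
   `D : T4Continuum.FiniteEpsData F G` (`C := D.C.toB12`, `β := D.βfun`, `hgen := D.fwd`, `L := F.L`, `m := F.m`), the
   unit inequality in the `∀ᶠ β in atTop` currency of the landed ceilings transfer.
HOW `stub_ceilings` WOULD USE IT (owner's pen; the lead's note «E0′ FIRST LEMMA» proposes the v5-K shape): E0′ proper
= «for runs in the interval, `(B)` ⇒ FBL6-type exterior-uniform cube bounds (shape K) ∕ Gibbs ceilings on the family
torus (shape T) at unit `L^{−K}`» (unprinted, XL) + THIS file ⇒ ceilings at a unit `a_B ≤ c·uRec` ⇒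
`MomentBounds6 … uRec` by `momentBounds6_uRec_of_fbl6_commensurable` ∕ `momentBounds6_of_eventually_le`.
HONEST FRAMING: conditional bookkeeping for an OPEN hypothesis of a conditional chain; nothing of Bałaban's programme is
asserted; the two-loop input is NOT in print for his scheme; not a mass gap, not Clay.
-/

set_option autoImplicit false

namespace Summit.QuantumFields.YangMills.Cruxes.UVSeamRec.FlowWindow

open Real Filter Topology Finset
open Literature.MathematicalPhysics.QuantumFieldTheory.Balaban1983to89

noncomputable section

/-! ## §4 The two-loop unit of record: with the matching coefficients the window reaches `uRec`

Normalisation.  Write the bare point as `x₀ = 1/g₀² = κ·β` (`β` the Wilson coupling of the seam's `wilsonMeasure`,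
density `exp(−β Σ_p Re tr(1 − U_p))`; for the tree's `SU(2)` instance of Bałaban's `GaugeGroup`, `reTr = ½ Re Tr`,
so `A = ½ Σ_p Re tr(1 − U_p)` and `κ = 2`).  The two-loop coefficients MATCHING the unit of record
`uRec β = exp(sizeLog β 1) = e^{−β/(4b₀)} (β/(2b₀))^{b₁/(2b₀²)}` are then `a = 4κ·b₀·log L` per step (one loop) and
`b = 8κ²·b₁·log L` (two loops): `(log L/a)·κβ = β/(4b₀)` and `b·log L/a² = b₁/(2b₀²)`.  For ANY `κ > 0` the theorem
below therefore reads: a one-sided two-loop upper bound with these coefficients (and any quartic remainder) puts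
the end of Bałaban's controlled window at most a CONSTANT factor above `uRec` — exactly the hypothesis
`∀ᶠ β, a β ≤ c · uRec β` of the landed ceilings transfer `CeilingsTransfer.momentBounds6_of_eventually_le`. -/

open Summit.QuantumFields.YangMills.Theorems.FemtoTransferGap (b0 b1 sizeLog)

/-- `b₀ = 11/(24π²) > 0`. [folklore] -/
theorem b0_pos : 0 < b0 := by unfold b0; positivity

/-- `b₁ = 17/(96π⁴) ≥ 0`. [folklore] -/
theorem b1_nonneg : 0 ≤ b1 := by unfold b1; positivity

/-- **The window reaches the two-loop unit (flow level).**  If `C` is forward-generated by `β` and `β` obeys, on the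
boxes `]0, γ₀]^{k+1}`, the one-sided two-loop bound `β_k(v) ≤ 4κb₀·log L + δ_k + 8κ²b₁·log L·v_k² + C·v_k⁴` (`L > 1`
the block size, `κ > 0` the normalisation of the bare point `1/g₀² = κβ`, `δ_k ≥ 0` a scale-dependent excess with
partial sums `≤ Δ`), then there are `γ ∈ ]0, γ₀]`, a step count
`K(β)`, a constant `c > 0` and a threshold `β₁` such that for every Wilson coupling `β ≥ β₁`: the run
`⟨K(β), m, (κβ)^{-1/2}⟩` stays in `]0, γ]` for EVERY torus exponent `m`, and `L^{−K(β)} ≤ c · uRec β`. [folklore] -/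
theorem window_reaches_uRec (C : B12.Construction) (β : FlowStep.HBeta)
    (hgen : DagBinding.ForwardGenerated C β) {L : ℕ} (hL : 1 < L) {κ Cr γ₀ Δ : ℝ} (hκ : 0 < κ) (hCr : 0 ≤ Cr)
    (hγ₀ : 0 < γ₀) (hΔ : 0 ≤ Δ) (δ : ℕ → ℝ) (hδ0 : ∀ k, 0 ≤ δ k) (hδ : ∀ n, ∑ k ∈ range n, δ k ≤ Δ)
    (h2L : ∀ (k : ℕ) (v : Fin (k + 1) → ℝ), v ∈ FlowStep.Box γ₀ k →
      β k v ≤ 4 * κ * b0 * Real.log L + δ k + 8 * κ ^ 2 * b1 * Real.log L * v (Fin.last k) ^ 2 +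
        Cr * v (Fin.last k) ^ 4) :
    ∃ γ : ℝ, 0 < γ ∧ γ ≤ γ₀ ∧ ∃ (Kβ : ℝ → ℕ) (c β₁ : ℝ), 0 < c ∧ ∀ βW : ℝ, β₁ ≤ βW →
      (∀ m : ℕ, (C ⟨Kβ βW, m, 1 / Real.sqrt (κ * βW)⟩).flow.InInterval γ (Kβ βW)) ∧
      ((L : ℝ) ^ Kβ βW)⁻¹ ≤ c * Transport.uRec βW := by
  have hLpos : (0 : ℝ) < L := by exact_mod_cast (zero_lt_one.trans hL)
  set ℓ : ℝ := Real.log L with hℓ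
  have hℓpos : 0 < ℓ := Real.log_pos (by exact_mod_cast hL)
  set a : ℝ := 4 * κ * b0 * ℓ with ha_def
  set b : ℝ := 8 * κ ^ 2 * b1 * ℓ with hb_def
  have ha : 0 < a := by have := b0_pos; positivity
  have hb : 0 ≤ b := by have := b1_nonneg; positivity
  have h2L' : ∀ (k : ℕ) (v : Fin (k + 1) → ℝ), v ∈ FlowStep.Box γ₀ k →
      β k v ≤ a + δ k + b * v (Fin.last k) ^ 2 + Cr * v (Fin.last k) ^ 4 := by
    intro k v hv; have := h2L k v hv; rw [ha_def, hb_def]; linarith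
  obtain ⟨γ, hγ, hγle, Hwin⟩ := inInterval_of_twoLoopUpper C β hgen ha hb hCr hγ₀ hΔ δ hδ0 hδ h2L'
  set X : ℝ := 1 / γ ^ 2 with hX
  have hXpos : 0 < X := by positivity
  -- remaining window length at Wilson coupling βW, and the step count
  set E₀ : ℝ := b / X + Cr / X ^ 2 + Cr / (a * X) with hE₀
  set r : ℝ → ℝ := fun βW => κ * βW - X - (Δ + b / a * Real.log (κ * βW / X) + E₀) with hr
  set Kβ : ℝ → ℕ := fun βW => ⌊r βW / a⌋₊ with hKβ
  -- the constant: (1 − r/a)·ℓ = c₂ + sizeLog βW 1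
  set c₂ : ℝ := ℓ + ℓ / a * (X + Δ + E₀) + b1 / (2 * b0 ^ 2) * (Real.log κ - Real.log X + Real.log (2 * b0))
    with hc₂
  refine ⟨γ, hγ, hγle, Kβ, Real.exp c₂, X / κ, Real.exp_pos _, fun βW hβW => ?_⟩
  have hκβ : X ≤ κ * βW := by rwa [div_le_iff₀ hκ, mul_comm] at hβW
  have hκβpos : 0 < κ * βW := lt_of_lt_of_le hXpos hκβ
  have hβpos : 0 < βW := pos_of_mul_pos_right hκβpos hκ.le  -- hmm: κ*βW > 0, κ > 0 ⇒ βW > 0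
  -- the bare coupling
  set g0 : ℝ := 1 / Real.sqrt (κ * βW) with hg0
  have hg0pos : 0 < g0 := by positivity
  have hg0sq : 1 / g0 ^ 2 = κ * βW := by
    rw [hg0, div_pow, one_pow, Real.sq_sqrt hκβpos.le, one_div_one_div]
  have hg0γ : g0 ≤ γ := le_of_inv_sq_le hg0pos hγ (by rw [hg0sq]; exact hκβ)
  refine ⟨fun m => ?_, ?_⟩
  · -- (i) the run stays in the interval along the window
    by_cases hr0 : 0 ≤ r βW
    · have hwin : a * (Kβ βW : ℝ) ≤ 1 / g0 ^ 2 - 1 / γ ^ 2 - (Δ + b / a * Real.log ((1 / g0 ^ 2) / (1 / γ ^ 2)) +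
          (b / (1 / γ ^ 2) + Cr / (1 / γ ^ 2) ^ 2 + Cr / (a * (1 / γ ^ 2)))) := by
        rw [hg0sq]
        have hfl : (Kβ βW : ℝ) ≤ r βW / a := Nat.floor_le (div_nonneg hr0 ha.le)
        calc a * (Kβ βW : ℝ) ≤ a * (r βW / a) := mul_le_mul_of_nonneg_left hfl ha.le
          _ = r βW := mul_div_cancel₀ _ ha.ne'
          _ = κ * βW - 1 / γ ^ 2 - (Δ + b / a * Real.log (κ * βW / (1 / γ ^ 2)) +
              (b / (1 / γ ^ 2) + Cr / (1 / γ ^ 2) ^ 2 + Cr / (a * (1 / γ ^ 2)))) := by rw [hr]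
      exact Hwin (Kβ βW) m g0 hg0pos hg0γ hwin
    · -- empty window: K = 0, and the bare coupling itself lies in ]0, γ]
      have hK0 : Kβ βW = 0 := by
        rw [hKβ]; exact Nat.floor_eq_zero.2 (by
          have : r βW / a < 0 := div_neg_of_neg_of_pos (lt_of_not_ge hr0) ha
          linarith)
      rw [hK0]
      intro k hk
      obtain rfl : k = 0 := Nat.le_zero.1 hk
      rw [hgen.1]
      exact ⟨hg0pos, hg0γ⟩
  · -- (ii) the unit inequality L^{-K(β)} ≤ e^{c₂} · uRec β
    have hK : r βW / a < (Kβ βW : ℝ) + 1 := Nat.lt_floor_add_one _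
    have hpow : ((L : ℝ) ^ Kβ βW)⁻¹ = Real.exp (-((Kβ βW : ℝ) * ℓ)) := by
      rw [Real.exp_neg, Real.exp_nat_mul, hℓ, Real.exp_log hLpos]
    rw [hpow, show Transport.uRec βW = Real.exp (sizeLog βW 1) from rfl, ← Real.exp_add, Real.exp_le_exp]
    -- the identity (1 − r/a)·ℓ = c₂ + sizeLog βW 1
    have hident : (1 - r βW / a) * ℓ = c₂ + sizeLog βW 1 := by
      have hlog1 : Real.log (κ * βW / X) = Real.log κ + Real.log βW - Real.log X := by
        rw [Real.log_div hκβpos.ne' hXpos.ne', Real.log_mul hκ.ne' hβpos.ne']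
      have hlog2 : Real.log (2 * b0 / βW) = Real.log (2 * b0) - Real.log βW :=
        Real.log_div (by have := b0_pos; positivity) hβpos.ne'
      simp only [hr, hc₂, sizeLog, hlog1, hlog2, Real.log_one, Nat.cast_one, hE₀]
      rw [ha_def, hb_def]
      have hb0 : b0 ≠ 0 := b0_pos.ne'
      field_simp
      ring
    have hle : -((Kβ βW : ℝ) * ℓ) ≤ (1 - r βW / a) * ℓ := by nlinarith
    linarith [hident]


/-! ## §5 At the datum: the flow half of E0′ for a finite-ε datum `D : FiniteEpsData F G`

`UV` (Theses/BalabanLadder.lean) quantifies `∀ F : T4Family, ∃ D : FiniteEpsData F SU(2), …`; the datum's coupling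
flows are forward-generated by its own history family `D.βfun` (field `D.fwd`).  Reading §4 at `C := D.C.toB12`,
`β := D.βfun`, `L := F.L` (odd, `> 11`), `m := F.m`: a one-sided two-loop bound on `D.βfun` with the coefficients
matching `uRec` puts, for every large Wilson coupling `β`, the run of `D.C` from the bare coupling `(κβ)^{-1/2}` inside
`]0, γ]` for `K(β)` steps with `F.L^{−K(β)} ≤ c · uRec β` — so [Balaban1989LargeFieldII] Thm 1 (`B16.Thm1Printed D.C`,
the first conjunct of `B16.EndStatementBPrinted D.C` = the `(B)` conjunct of `UV`) APPLIES to that run, and the unit it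
controls is commensurable (one-sidedly, which is all `momentBounds6_of_eventually_le` asks) with the unit of record.
NO conjunct of `UV` supplies the two-loop bound: it is the located flow-side input of `stub_ceilings`. -/

/-- **The flow half of E0′ at a finite-ε datum.**  For `D : FiniteEpsData F G` whose history β-functions `D.βfun`
obey the one-sided two-loop bound `β_k(v) ≤ 4κb₀·log L + δ_k + 8κ²b₁·log L·v_k² + C·v_k⁴` on the boxes
`]0, γ₀]^{k+1}` (`L = F.L`, `Σ δ_k ≤ Δ`): some `γ ∈ ]0, γ₀]`, step count `K(β)`, `c > 0`, `β₁` give, for every Wilson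
coupling `β ≥ β₁`, a run
`D.C ⟨K(β), F.m, (κβ)^{-1/2}⟩` inside `]0, γ]` (the hypothesis of [Balaban1989LargeFieldII] Thm 1 for it) whose
unit `F.L^{−K(β)}` is `≤ c · uRec β`. [folklore] -/
theorem datum_window_reaches_uRec {F : T4Continuum.T4Family} {G : Type*} [GaugeGroup G] [MeasurableSpace G]
    [HaarData G] (D : T4Continuum.FiniteEpsData F G) {κ Cr γ₀ Δ : ℝ} (hκ : 0 < κ) (hCr : 0 ≤ Cr) (hγ₀ : 0 < γ₀)
    (hΔ : 0 ≤ Δ) (δ : ℕ → ℝ) (hδ0 : ∀ k, 0 ≤ δ k) (hδ : ∀ n, ∑ k ∈ range n, δ k ≤ Δ)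
    (h2L : ∀ (k : ℕ) (v : Fin (k + 1) → ℝ), v ∈ FlowStep.Box γ₀ k →
      D.βfun k v ≤ 4 * κ * b0 * Real.log F.L + δ k + 8 * κ ^ 2 * b1 * Real.log F.L * v (Fin.last k) ^ 2 +
        Cr * v (Fin.last k) ^ 4) :
    ∃ γ : ℝ, 0 < γ ∧ γ ≤ γ₀ ∧ ∃ (Kβ : ℝ → ℕ) (c β₁ : ℝ), 0 < c ∧ ∀ βW : ℝ, β₁ ≤ βW →
      (D.C ⟨Kβ βW, F.m, 1 / Real.sqrt (κ * βW)⟩).flow.InInterval γ (Kβ βW) ∧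
      ((F.L : ℝ) ^ Kβ βW)⁻¹ ≤ c * Transport.uRec βW := by
  obtain ⟨γ, hγ, hγle, Kβ, c, β₁, hc, H⟩ :=
    window_reaches_uRec D.C.toB12 D.βfun D.fwd F.hL.2 hκ hCr hγ₀ hΔ δ hδ0 hδ h2L
  exact ⟨γ, hγ, hγle, Kβ, c, β₁, hc, fun βW hβW => ⟨(H βW hβW).1 F.m, (H βW hβW).2⟩⟩

/-- The unit inequality in the `∀ᶠ β in atTop` currency of the landed ceilings transfer
(`CeilingsTransfer.momentBounds6_of_eventually_le`, `FloorsEngineOfWindow.momentBounds6_uRec_of_fbl6_commensurable`):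
Bałaban's unit `a_B β := F.L^{−K(β)}` satisfies `∀ᶠ β in atTop, a_B β ≤ c · uRec β`, and eventually every run
`D.C ⟨K(β), F.m, (κβ)^{-1/2}⟩` is in the interval. [folklore] -/
theorem datum_unit_eventually_le {F : T4Continuum.T4Family} {G : Type*} [GaugeGroup G] [MeasurableSpace G]
    [HaarData G] (D : T4Continuum.FiniteEpsData F G) {κ Cr γ₀ Δ : ℝ} (hκ : 0 < κ) (hCr : 0 ≤ Cr) (hγ₀ : 0 < γ₀)
    (hΔ : 0 ≤ Δ) (δ : ℕ → ℝ) (hδ0 : ∀ k, 0 ≤ δ k) (hδ : ∀ n, ∑ k ∈ range n, δ k ≤ Δ)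
    (h2L : ∀ (k : ℕ) (v : Fin (k + 1) → ℝ), v ∈ FlowStep.Box γ₀ k →
      D.βfun k v ≤ 4 * κ * b0 * Real.log F.L + δ k + 8 * κ ^ 2 * b1 * Real.log F.L * v (Fin.last k) ^ 2 +
        Cr * v (Fin.last k) ^ 4) :
    ∃ γ : ℝ, 0 < γ ∧ γ ≤ γ₀ ∧ ∃ (Kβ : ℝ → ℕ) (c : ℝ), 0 < c ∧
      (∀ᶠ βW in atTop, (D.C ⟨Kβ βW, F.m, 1 / Real.sqrt (κ * βW)⟩).flow.InInterval γ (Kβ βW)) ∧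
      ∀ᶠ βW in atTop, ((F.L : ℝ) ^ Kβ βW)⁻¹ ≤ c * Transport.uRec βW := by
  obtain ⟨γ, hγ, hγle, Kβ, c, β₁, hc, H⟩ := datum_window_reaches_uRec D hκ hCr hγ₀ hΔ δ hδ0 hδ h2L
  exact ⟨γ, hγ, hγle, Kβ, c, hc, eventually_atTop.2 ⟨β₁, fun βW h => (H βW h).1⟩,
    eventually_atTop.2 ⟨β₁, fun βW h => (H βW h).2⟩⟩

end

end Summit.QuantumFields.YangMills.Cruxes.UVSeamRec.FlowWindow
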